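import Literature.Analysis.FluidPDE.LerayHopfRestartEverywhere
import Literature.Analysis.FluidPDE.LerayHopfRestart
import Literature.Analysis.FluidPDE.ClassicalBoundedWeak
import Literature.Analysis.FluidPDE.ClassicalSolutionGlue
import Literature.Analysis.FluidPDE.MollifiedSolenoidalTest
import HarnessLib

/-!
# Classical solutions of the forced Navier–Stokes system on an open time strip are Leray–Hopf
  solutions from the datum they attain in `L²`

Analysis/FluidPDE proofs-layer file (theorems only, no definitions, no named facts). It is the
**forced** twin of the tree's `isLerayHopfOn_of_classical_Ioo`
(`NSLerayStrongLocalExistence.lean`, unforced system on `ℝ³`, Ożański–Pooley 2018, Lemma 6.21),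
stated for a general finite-dimensional inner product space `E`, and serves the formalisation of
the proof line of Albritton–Brué–Colombo 2022 (Ann. of Math. 196, Thm. 1.2 / Thm. 1.3; in-tree
named facts `albritton_brue_colombo`, `albritton_brue_colombo_unit`): the two non-unique solutions
constructed there are self-similar-type fields `u(x,t) = t^{-1/2} U(x/√t, log t)` driven by the
force `f(x,t) = t^{-3/2} F(x/√t)` — smooth solutions of the forced system for `t > 0` only, with
`‖u(t)‖_{L²} ≲ t^{1/4} → 0` ((1.13) there) — and the statement "`ū`, `u` are Leray–Hopf solutions
with datum `u₀ ≡ 0`" is exactly an instance of the main theorem below. Nothing here is specific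
to that paper.

## Main results (all proved)

* `IsClassicalNSSolutionOn.weakIdentity_test_Ioo` — the pressure-free identity
  `∫∫ (⟪u, ∂ₜψ⟫ + ⟪u, (u·∇)ψ⟫ + ν⟪u, Δψ⟫ + ⟪f, ψ⟫) = 0` of a forced classical solution on an open
  time strip `(a, b)` against divergence-free test fields compactly supported in the open slab
  (Leray 1934, §III (17); the forced twin of `IsClassicalNSSolutionOn.isBoundedWeakNSSolutionOn`).
* `IsClassicalNSSolutionOn.energyEq_Ioo_forced` — Leray's energy equality
  `½‖u(t)‖₂² + ν∫ₛᵗ∫|∇u|² = ½‖u(s)‖₂² + ∫ₛᵗ∫⟪f, u⟫` on interior intervals `0 < s < t < T` of an open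
  strip, from the tree's closed-slab energy equality (`IsClassicalNSSolutionOn.energyEq`,
  `LerayHopfProofs.lean`) applied to time translates (Leray 1934, (3.4); Ożański–Pooley 2018,
  Thm. 6.17).
* `integrableOn_forcePairing_of_continuousOn` — the work of the force `τ ↦ ∫⟪f, u⟫(τ)` is
  integrable on `(0, T)` when `∫₀ᵀ∫|f||u| < ∞` (Tonelli/Fubini on the open slab).
* `isLerayHopfOn_of_classical_Ioo_forced` — **the main theorem**: a classical solution `(u, p)`
  of the forced system on `E × (0, T)` with `sup ‖u(t)‖₂ < ∞`, `∇u ∈ L²((0,T) × E)`,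
  `⟪f, u⟫ ∈ L¹((0,T) × E)`, `f ∈ L¹` on finite cylinders, `u ∈ L³` and `p u ∈ L¹` on interior
  slabs, extended by `v(0) = u₀ ∈ L²` with `v ∈ C([0,T); L²)`, is a Leray–Hopf weak solution on
  `[0, T')` from `u₀` with force `f` for every `T' < T` (accepted strict-sense
  `IsLerayHopfOn`, with energy *equalities*). Proof as in the unforced tree version: weak
  formulation by the cut-off argument `weakIdentity_datum_of_tested` (Robinson–Rodrigo–Sadowski
  2016, §3.1) from the pressure-free identity and the strong attainment of the datum; energy
  equality from `0` as the limit `s → 0⁺` of the interior one (kinetic term by `L²` continuity,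
  dissipation by monotone convergence, work of the force by continuity of the primitive of an
  integrable function); weak/strong continuity from `C([0,T); L²)`.

## Design notes

* The gradient hypothesis is global, `∇u ∈ L²((0,T) × E)` (it is a clause of the conclusion);
  the `L³` and `p u ∈ L¹` hypotheses are only needed on interior slabs, where they feed Leray's
  cut-off proof of the energy equality; no sign or size condition on `ν`.
* `v` versus `u`: as in the unforced version the solution may be re-defined at `t = 0` (and is
  arbitrary off `[0, T)`); only `v = u` on `(0, T)` and `v 0 = u₀` are used.
* Continuity into `L²` on `[0, T)` is a hypothesis here. For finite-energy classical solutions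
  on `ℝ³` it follows on `(0, T)` from the energy equality and weak continuity (cf.
  `continuousInLpOn_of_energy_of_weak`, `TaoFiniteEnergyLerayHopf.lean`), so that only the
  attainment of the datum at `0⁺` is a genuine assumption; that reduction is left to a sequel.

## Tree / Mathlib search

Tree (`lean search`): `isLerayHopfOn_of_classical_Ioo`, `energyEq_Ioo`,
`lintegral_dissipation_Ioo_le` (unforced, `NSLerayStrongLocalExistence`);
`IsClassicalNSSolutionOn.energyEq`, `eEnergy_eq_eLpNorm_sq` (`LerayHopfProofs`);
`integral_inner_timeDerivWithin_test`, `continuousOn_force`, `integrable_prod_of_continuousOn`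
(`ClassicalSolutionCalculus`); `isBoundedWeakNSSolutionOn` (`ClassicalBoundedWeak`, whose proof
is followed verbatim with the force added); `weakIdentity_datum_of_tested` (`LerayHopfRestart`);
`integrableOn_cylinder_of_lintegral_sq_slab`, `ae_slice_aestronglyMeasurable_and_lintegral_ball_lt_top`,
`volume_restrict_slab_eq` (`DistributionalToWeak`); `tendsto_setLIntegral_Ioo_left`,
`ContinuousInLpOn.tendsto_kineticEnergy` (`LerayHopfRestartEverywhere`);
`ContinuousInLpOn.continuousOn_integral_inner`, `tendsto_integral_inner_left_of_tendsto_eLpNorm`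
(`MollifiedSolenoidalTest`); `comp_add_right` (`ClassicalSolutionGlue`);
`setLIntegral_Ioo_comp_add_right` (`LerayHopfTranslate`). Mathlib: `lintegral_prod_le`,
`Integrable.integral_prod_left`, `intervalIntegral.continuousOn_primitive_interval_left`,
`intervalIntegral.integral_comp_add_right`, `integrableOn_Icc_iff_integrableOn_Ioo`.

## References

* J. Leray, *Sur le mouvement d'un liquide visqueux emplissant l'espace*, Acta Math. 63 (1934),
  §III (17) p. 206, §17 (3.4) p. 220, §32 p. 242. [Leray1934]
* W. S. Ożański, B. C. Pooley, *Leray's fundamental work on the Navier–Stokes equations*, LMS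
  Lecture Note Ser. 452 (2018) = arXiv:1708.09787, Thm. 6.17, Def. 6.20, Lemma 6.21.
  [OzanskiPooley2018]
* J. C. Robinson, J. L. Rodrigo, W. Sadowski, *The three-dimensional Navier–Stokes equations*,
  CUP 2016, §3.1. [RobinsonRodrigoSadowski2016]
* D. Albritton, E. Brué, M. Colombo, *Non-uniqueness of Leray solutions of the forced
  Navier–Stokes equations*, Ann. of Math. 196 (2022) = arXiv:2112.03116, Def. 1.1, Thm. 1.3 and
  (1.13)–(1.14). [AlbrittonBrueColombo2022]
-/

noncomputable section

open MeasureTheory TopologicalSpace Set Function Filter Topology InnerProductSpace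
open scoped RealInnerProductSpace ENNReal NNReal Laplacian

namespace Literature.Analysis.FluidPDE

section PressureFree

variable {E : Type*} [NormedAddCommGroup E] [InnerProductSpace ℝ E] [FiniteDimensional ℝ E]
  [MeasurableSpace E] [BorelSpace E]

/-- **The pressure-free identity of a forced classical solution on an open time strip.** For a
classical solution `(u, p)` of the Navier–Stokes system with force `f` on `E × (a, b)` and a
smooth compactly supported test field `ψ` on the open slab `(a, b) × E` with divergence-free
slices, `∫∫ (⟪u, ∂ₜψ⟫ + ⟪u, (u·∇)ψ⟫ + ν⟪u, Δψ⟫ + ⟪f, ψ⟫) = 0`: the time support of `ψ` lies in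
some `[a', b'] ⊂ (a, b)`; on a compact `[a₁, b₁] ⊂ (a, b)` around it the slice identity
`∫⟪∂ₜu, ψ⟫ = ∫⟪u, (u·∇)ψ⟫ + ν∫⟪u, Δψ⟫ + ∫⟪f, ψ⟫` (`integral_inner_timeDerivWithin_test`: the
pressure drops out against divergence-free fields) turns the integrand into `d/dt ∫⟪u, ψ⟫`,
whose integral over `[a₁, b₁]` vanishes because `ψ(a₁) = ψ(b₁) = 0` (Leray 1934, §III (17);
the forced twin of `IsClassicalNSSolutionOn.isBoundedWeakNSSolutionOn`, KNSS 2009, §4 (ii)).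
No integrability of `u`, `p` or `f` at the ends of the strip is needed. [cite: Leray1934, §III (17) p. 206] -/
theorem IsClassicalNSSolutionOn.weakIdentity_test_Ioo {a b ν : ℝ} {f u : ℝ → E → E}
    {p : ℝ → E → ℝ} (h : IsClassicalNSSolutionOn (Ioo a b) ν f u p) {ψ : ℝ → E → E}
    (hψ : IsSpaceTimeTestOn (slab E (Ioo a b) isOpen_Ioo) ψ)
    (hdiv : ∀ t, VectorCalculus.IsDivFree (ψ t)) :
    ∫ t in Ioo a b, ∫ x, (⟪u t x, timeDeriv ψ t x⟫ + ⟪u t x, convect (u t) (ψ t) x⟫ +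
        ν * ⟪u t x, Δ (ψ t) x⟫ + ⟪f t x, ψ t x⟫) = 0 := by
  rcases le_or_gt b a with hab | hab
  · simp [Ioo_eq_empty_of_le hab]
  -- time support `[a', b'] ⊂ (a, b)` and a compact interval `[a₁, b₁]` around it
  obtain ⟨a', b', haa', ha'b', hb'b, hsupp⟩ := hψ.exists_time_support_Ioo hab
  set a₁ : ℝ := (a + a') / 2 with ha₁
  set b₁ : ℝ := (b' + b) / 2 with hb₁
  have haa₁ : a < a₁ := by rw [ha₁]; linarith
  have ha₁a' : a₁ < a' := by rw [ha₁]; linarith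
  have hb'b₁ : b' < b₁ := by rw [hb₁]; linarith
  have hb₁b : b₁ < b := by rw [hb₁]; linarith
  have ha₁b₁ : a₁ < b₁ := by linarith
  have hsub : Icc a₁ b₁ ⊆ Ioo a b := fun t ht => ⟨haa₁.trans_le ht.1, ht.2.trans_lt hb₁b⟩
  set S₀ : Set ℝ := Icc a₁ b₁ with hS₀
  have hU : UniqueDiffOn ℝ S₀ := uniqueDiffOn_Icc ha₁b₁
  have h₀ : IsClassicalNSSolutionOn S₀ ν f u p := h.mono hsub hU
  have hu₀ : ContinuousOn (uncurry u) (S₀ ×ˢ univ) := h₀.smooth_velocity.continuousOn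
  have hf₀ : ContinuousOn (uncurry f) (S₀ ×ˢ univ) := h₀.continuousOn_force hU
  have hdt_cont : ContinuousOn (uncurry (timeDerivWithin S₀ u)) (S₀ ×ˢ univ) :=
    (h₀.smooth_velocity.timeDerivWithin hU).continuousOn
  -- values of `ψ` and its derived fields off the time support
  have hψ0 : ∀ t, t ∉ Icc a' b' → ∀ x, ψ t x = 0 := fun t ht x => by rw [hsupp t ht]; rfl
  have hψa₁ : ∀ x, ψ a₁ x = 0 := hψ0 a₁ fun ht => (not_le.2 ha₁a') ht.1
  have hψb₁ : ∀ x, ψ b₁ x = 0 := hψ0 b₁ fun ht => (not_le.2 hb'b₁) ht.2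
  have hzero : ∀ t, t ∉ Icc a' b' → ∀ x,
      ⟪u t x, timeDeriv ψ t x⟫ + ⟪u t x, convect (u t) (ψ t) x⟫ + ν * ⟪u t x, Δ (ψ t) x⟫ +
        ⟪f t x, ψ t x⟫ = 0 := by
    intro t ht x
    have hopen : IsOpen (Icc a' b')ᶜ := isClosed_Icc.isOpen_compl
    have hnear : (fun s => ψ s x) =ᶠ[𝓝 t] fun _ => (0 : E) :=
      Filter.eventually_of_mem (hopen.mem_nhds ht) fun s hs => hψ0 s hs x
    have h1 : timeDeriv ψ t x = 0 := by
      rw [timeDeriv_apply, hnear.deriv_eq, deriv_const]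
    have h2 : fderiv ℝ (ψ t) x = 0 := by
      rw [show ψ t = fun _ => (0 : E) from funext (hψ0 t ht), fderiv_fun_const, Pi.zero_apply]
    have h3 : Δ (ψ t) x = 0 :=
      laplacian_eq_zero_of_notMem_tsupport (by
        rw [hsupp t ht, tsupport_eq_empty_iff.2 rfl]; exact notMem_empty x)
    rw [h1, convect_apply, h2, h3, hψ0 t ht x]
    simp
  -- reduce the time integral to `(a₁, b₁)`
  rw [setIntegral_eq_of_subset_of_forall_sdiff_eq_zero (measurableSet_Ioo (a := a) (b := b))
    (Ioo_subset_Ioo haa₁.le hb₁b.le : Ioo a₁ b₁ ⊆ Ioo a b)]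
  swap
  · intro t ht
    have ht' : t ∉ Icc a' b' := fun h' => ht.2 ⟨ha₁a'.trans_le h'.1, h'.2.trans_lt hb'b₁⟩
    simp only [hzero t ht', integral_zero]
  -- the compact `x`-shadow of the test field
  obtain ⟨K, hK, hKt⟩ := hψ.exists_compact_slice_subset
  have hψK : ∀ t, ∀ x ∉ K, ψ t x = 0 := fun t x hx =>
    image_eq_zero_of_notMem_tsupport fun h' => hx (hKt t h')
  -- the space–time integrand `∂ₜ ⟪u, ψ⟫`
  set D : ℝ × E → ℝ := fun z => ⟪u z.1 z.2, timeDeriv ψ z.1 z.2⟫ +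
    ⟪timeDerivWithin S₀ u z.1 z.2, ψ z.1 z.2⟫ with hD
  have hDcont : ContinuousOn D (Icc a₁ b₁ ×ˢ univ) := by
    refine ContinuousOn.add (ContinuousOn.inner hu₀ hψ.continuous_timeDeriv.continuousOn)
      (ContinuousOn.inner hdt_cont ?_)
    exact hψ.contDiff.continuous.continuousOn
  have hDK : ∀ t ∈ Icc a₁ b₁, ∀ x ∉ K, D (t, x) = 0 := fun t _ x hx => by
    simp only [hD]
    rw [hψK t x hx, timeDeriv_eq_zero_of_forall (fun s => hψK s x hx)]
    simp
  have hDint := integrable_prod_of_continuousOn hK hDcont hDK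
  -- slice identity for every `t ∈ (a₁, b₁)`
  have hslice : ∀ t ∈ Ioo a₁ b₁, ∫ x, (⟪u t x, timeDeriv ψ t x⟫ +
      ⟪u t x, convect (u t) (ψ t) x⟫ + ν * ⟪u t x, (Δ (ψ t)) x⟫ + ⟪f t x, ψ t x⟫) =
      ∫ x, D (t, x) := by
    intro t ht
    have ht' : t ∈ S₀ := Ioo_subset_Icc_self ht
    have hψ2 : ContDiff ℝ 2 (ψ t) := contDiff_infty.1 (hψ.contDiff_slice t) 2
    have key := h₀.integral_inner_timeDerivWithin_test hU ht' hψ2 (hψ.hasCompactSupport_slice t)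
      (hdiv t)
    have huc : Continuous (u t) := (h₀.contDiff_velocity ht').continuous
    have hfc : Continuous (f t) := h₀.continuous_force_slice hU ht'
    have i1 : Integrable (fun x => ⟪u t x, timeDeriv ψ t x⟫) (volume : Measure E) :=
      integrable_inner_of_hasCompactSupport_right huc
        (hψ.continuous_timeDeriv.comp (Continuous.prodMk_right t))
        (HasCompactSupport.intro hK fun x hx => timeDeriv_eq_zero_of_forall
          (fun s => hψK s x hx) t)
    have i2 : Integrable (fun x => ⟪timeDerivWithin S₀ u t x, ψ t x⟫) (volume : Measure E) :=
      integrable_inner_of_hasCompactSupport_right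
        (((h₀.smooth_velocity.timeDerivWithin hU).contDiff_slice ht').continuous)
        (hψ.contDiff_slice t).continuous (hψ.hasCompactSupport_slice t)
    have hψ1 : ContDiff ℝ 1 (ψ t) := hψ2.of_le one_le_two
    have iC' : Integrable (fun x => ⟪u t x, convect (u t) (ψ t) x⟫) (volume : Measure E) :=
      integrable_inner_of_hasCompactSupport_right huc
        ((hψ1.continuous_fderiv one_ne_zero).clm_apply huc)
        (((hψ.hasCompactSupport_slice t).fderiv (𝕜 := ℝ)).mono fun x hx => by
          contrapose! hx; simp only [mem_support, not_not] at hx; simp [convect, hx])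
    have iL' : Integrable (fun x => ν * ⟪u t x, (Δ (ψ t)) x⟫) (volume : Measure E) :=
      (integrable_inner_of_hasCompactSupport_right huc (continuous_laplacian hψ2)
        ((hψ.hasCompactSupport_slice t).mono' fun x hx => by
          contrapose! hx; simp [laplacian_eq_zero_of_notMem_tsupport hx])).const_mul ν
    have iF : Integrable (fun x => ⟪f t x, ψ t x⟫) (volume : Measure E) :=
      integrable_inner_of_hasCompactSupport_right hfc (hψ.contDiff_slice t).continuous
        (hψ.hasCompactSupport_slice t)
    calc ∫ x, (⟪u t x, timeDeriv ψ t x⟫ + ⟪u t x, convect (u t) (ψ t) x⟫ +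
          ν * ⟪u t x, (Δ (ψ t)) x⟫ + ⟪f t x, ψ t x⟫)
        = ∫ x, (⟪u t x, timeDeriv ψ t x⟫ + (⟪u t x, convect (u t) (ψ t) x⟫ +
          ν * ⟪u t x, (Δ (ψ t)) x⟫ + ⟪f t x, ψ t x⟫)) :=
          integral_congr_ae (Eventually.of_forall fun x => by ring)
      _ = (∫ x, ⟪u t x, timeDeriv ψ t x⟫) + ∫ x, ⟪timeDerivWithin S₀ u t x, ψ t x⟫ := by
          have i3 : Integrable (fun x => ⟪u t x, convect (u t) (ψ t) x⟫ +
              ν * ⟪u t x, (Δ (ψ t)) x⟫ + ⟪f t x, ψ t x⟫) (volume : Measure E) :=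
            (iC'.add iL').add iF
          rw [integral_add i1 i3, key]
      _ = ∫ x, D (t, x) := (integral_add i1 i2).symm
  -- integrate the slice identity in time and swap the integrals
  have hstep : ∫ t in Ioo a₁ b₁, ∫ x, (⟪u t x, timeDeriv ψ t x⟫ +
      ⟪u t x, convect (u t) (ψ t) x⟫ + ν * ⟪u t x, (Δ (ψ t)) x⟫ + ⟪f t x, ψ t x⟫) =
      ∫ x, ∫ t in Ioo a₁ b₁, D (t, x) := by
    rw [setIntegral_congr_fun measurableSet_Ioo hslice]
    exact integral_integral_swap (f := fun t x => D (t, x)) hDint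
  -- fundamental theorem of calculus on each time line: both boundary terms vanish
  have hline : ∀ x, ∫ t in Ioo a₁ b₁, D (t, x) = 0 := by
    intro x
    have hcont : ContinuousOn (fun t => ⟪u t x, ψ t x⟫) (Icc a₁ b₁) := by
      refine ContinuousOn.inner ?_ ?_
      · exact hu₀.comp (Continuous.prodMk_left x).continuousOn
          fun t ht => mk_mem_prod ht (mem_univ x)
      · exact (hψ.contDiff.continuous.comp (Continuous.prodMk_left x)).continuousOn
    have hderiv : ∀ t ∈ Ioo a₁ b₁, HasDerivWithinAt (fun t => ⟪u t x, ψ t x⟫) (D (t, x))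
        (Ioi t) t := by
      intro t ht
      have hu' : HasDerivAt (fun s => u s x) (timeDerivWithin S₀ u t x) t :=
        (h₀.smooth_velocity.hasDerivWithinAt_timeDerivWithin hU (Ioo_subset_Icc_self ht)
          x).hasDerivAt (Icc_mem_nhds ht.1 ht.2)
      exact (hu'.inner ℝ (hψ.hasDerivAt_time t x)).hasDerivWithinAt
    have hint : IntervalIntegrable (fun t => D (t, x)) volume a₁ b₁ := by
      refine ContinuousOn.intervalIntegrable ?_
      rw [uIcc_of_le ha₁b₁.le]
      exact hDcont.comp (Continuous.prodMk_left x).continuousOn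
        fun t ht => mk_mem_prod ht (mem_univ x)
    have := intervalIntegral.integral_eq_sub_of_hasDeriv_right_of_le ha₁b₁.le hcont hderiv hint
    rw [intervalIntegral.integral_of_le ha₁b₁.le, integral_Ioc_eq_integral_Ioo] at this
    rw [this, hψa₁ x, hψb₁ x, inner_zero_right, inner_zero_right, sub_self]
  rw [hstep, integral_congr_ae (Eventually.of_forall hline), integral_zero]

end PressureFree

/-! ### The energy equality on interior intervals of the open strip -/

section InteriorEnergy

variable {E : Type*} [NormedAddCommGroup E] [InnerProductSpace ℝ E] [FiniteDimensional ℝ E]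
  [MeasurableSpace E] [BorelSpace E]
variable {T ν : ℝ} {f u : ℝ → E → E} {p : ℝ → E → ℝ}

omit [MeasurableSpace E] [BorelSpace E] in
/-- Time translation of a forced classical solution on `(0, T)` onto a closed slab `[0, T₁]`,
`[s, s + T₁] ⊂ (0, T)`: `(u, p, f)(· + s)` is a classical solution on `[0, T₁]` (autonomy,
`IsClassicalNSSolutionOn.comp_add_right`; the forced twin of
`IsClassicalNSSolutionOn.translate_Icc_of_Ioo`). [folklore] -/
theorem IsClassicalNSSolutionOn.translate_Icc_of_Ioo_forced
    (hcl : IsClassicalNSSolutionOn (Ioo 0 T) ν f u p) {s T₁ : ℝ} (hs : 0 < s) (hT₁ : 0 < T₁)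
    (hsT : s + T₁ < T) :
    IsClassicalNSSolutionOn (Icc 0 T₁) ν (fun τ => f (τ + s)) (fun τ => u (τ + s))
      (fun τ => p (τ + s)) :=
  (hcl.comp_add_right s).mono (fun τ hτ => ⟨by linarith [hτ.1], by linarith [hτ.2]⟩)
    (uniqueDiffOn_Icc hT₁)

/-- **Energy equality on interior intervals of an open strip, forced system** (Leray 1934, §17
(3.4), "relation de dissipation de l'énergie"; Ożański–Pooley 2018, Thm. 6.17). Let `(u, p)` be
a classical solution of the Navier–Stokes system with force `f` on `E × (0, T)` with
`sup_{0<t<T} ‖u(t)‖_{L²} ≤ L < ∞`, and such that on every interior slab `(s, t) × E`,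
`0 < s < t < T`, one has `∇u ∈ L²`, `u ∈ L³` and `p u, ⟪f, u⟫ ∈ L¹`. Then for `0 < s < t < T`
`½‖u(t)‖₂² + ν∫ₛᵗ∫|∇u|² = ½‖u(s)‖₂² + ∫ₛᵗ∫⟪f, u⟫`. Proof: the translate `(u, p, f)(· + s)` is a
classical solution on the closed slab `[0, t − s]` (`translate_Icc_of_Ioo_forced`), to which the
tree's energy equality for classical solutions on closed slabs
(`IsClassicalNSSolutionOn.energyEq`, Leray's cut-off argument) applies; then undo the
translation (`setLIntegral_Ioo_comp_add_right`, `intervalIntegral.integral_comp_add_right`).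
Nothing is assumed at `t = 0`. [cite: Leray1934, §17 (3.4) p. 220] [cite: OzanskiPooley2018, Thm. 6.17] -/
theorem IsClassicalNSSolutionOn.energyEq_Ioo_forced
    (hcl : IsClassicalNSSolutionOn (Ioo 0 T) ν f u p) {L : ℝ≥0∞} (hLt : L ≠ ⊤)
    (hL : ∀ t ∈ Ioo 0 T, eLpNorm (u t) 2 volume ≤ L)
    (hgrad : ∀ s t : ℝ, 0 < s → s < t → t < T →
      ∫⁻ τ in Ioo s t, ∫⁻ x, ENNReal.ofReal (frobeniusNormSq (fderiv ℝ (u τ) x)) < ∞)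
    (hu₃ : ∀ s t : ℝ, 0 < s → s < t → t < T →
      ∫⁻ τ in Ioo s t, ∫⁻ x, ‖u τ x‖ₑ ^ (3 : ℕ) < ∞)
    (hpu : ∀ s t : ℝ, 0 < s → s < t → t < T →
      ∫⁻ τ in Ioo s t, ∫⁻ x, ‖p τ x‖ₑ * ‖u τ x‖ₑ < ∞)
    (hfu : ∀ s t : ℝ, 0 < s → s < t → t < T →
      ∫⁻ τ in Ioo s t, ∫⁻ x, ‖f τ x‖ₑ * ‖u τ x‖ₑ < ∞)
    {s t : ℝ} (hs : 0 < s) (hst : s < t) (htT : t < T) :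
    VectorCalculus.kineticEnergy (u t) +
        ν * (∫⁻ τ in Ioo s t, ∫⁻ x, ENNReal.ofReal (frobeniusNormSq (fderiv ℝ (u τ) x))).toReal =
      VectorCalculus.kineticEnergy (u s) + ∫ τ in s..t, ∫ x, ⟪f τ x, u τ x⟫ := by
  have hts : 0 < t - s := sub_pos.2 hst
  have h' := hcl.translate_Icc_of_Ioo_forced hs hts (by linarith)
  have hIoo : ∀ {τ : ℝ}, τ ∈ Icc 0 (t - s) → τ + s ∈ Ioo 0 T := fun hτ =>
    ⟨by linarith [hτ.1], by linarith [hτ.2]⟩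
  -- the slices of the translate
  have hmemI : ∀ τ ∈ Icc 0 (t - s), MemLp (u (τ + s)) 2 volume := fun τ hτ =>
    ⟨(hcl.contDiff_velocity (hIoo hτ)).continuous.aestronglyMeasurable,
      (hL _ (hIoo hτ)).trans_lt hLt.lt_top⟩
  have hM : ∀ τ ∈ Icc 0 (t - s), eEnergy (u (τ + s)) ≤ L ^ 2 := fun τ hτ => by
    rw [eEnergy_eq_eLpNorm_sq]
    gcongr
    exact hL _ (hIoo hτ)
  -- change of variables `τ ↦ τ + s` in the four space–time hypotheses
  have hshift : ∀ g : ℝ → ℝ≥0∞, ∫⁻ τ in Ioo 0 (t - s), g (τ + s) = ∫⁻ τ in Ioo s t, g τ := by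
    intro g
    have h1 := setLIntegral_Ioo_comp_add_right g 0 (t - s) s
    simpa only [zero_add, sub_add_cancel] using h1
  have hgradI : ∫⁻ τ in Ioo 0 (t - s), ∫⁻ x,
      ENNReal.ofReal (frobeniusNormSq (fderiv ℝ (u (τ + s)) x)) < ∞ := by
    have h1 : ∫⁻ τ in Ioo 0 (t - s), ∫⁻ x,
        ENNReal.ofReal (frobeniusNormSq (fderiv ℝ (u (τ + s)) x)) =
        ∫⁻ τ in Ioo s t, ∫⁻ x, ENNReal.ofReal (frobeniusNormSq (fderiv ℝ (u τ) x)) :=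
      hshift (fun τ => ∫⁻ x, ENNReal.ofReal (frobeniusNormSq (fderiv ℝ (u τ) x)))
    rw [h1]
    exact hgrad s t hs hst htT
  have hu₃I : ∫⁻ τ in Ioo 0 (t - s), ∫⁻ x, ‖u (τ + s) x‖ₑ ^ (3 : ℕ) < ∞ := by
    have h1 : ∫⁻ τ in Ioo 0 (t - s), ∫⁻ x, ‖u (τ + s) x‖ₑ ^ (3 : ℕ) =
        ∫⁻ τ in Ioo s t, ∫⁻ x, ‖u τ x‖ₑ ^ (3 : ℕ) :=
      hshift (fun τ => ∫⁻ x, ‖u τ x‖ₑ ^ (3 : ℕ))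
    rw [h1]
    exact hu₃ s t hs hst htT
  have hpuI : ∫⁻ τ in Ioo 0 (t - s), ∫⁻ x, ‖p (τ + s) x‖ₑ * ‖u (τ + s) x‖ₑ < ∞ := by
    have h1 : ∫⁻ τ in Ioo 0 (t - s), ∫⁻ x, ‖p (τ + s) x‖ₑ * ‖u (τ + s) x‖ₑ =
        ∫⁻ τ in Ioo s t, ∫⁻ x, ‖p τ x‖ₑ * ‖u τ x‖ₑ :=
      hshift (fun τ => ∫⁻ x, ‖p τ x‖ₑ * ‖u τ x‖ₑ)
    rw [h1]
    exact hpu s t hs hst htT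
  have hfuI : ∫⁻ τ in Ioo 0 (t - s), ∫⁻ x, ‖f (τ + s) x‖ₑ * ‖u (τ + s) x‖ₑ < ∞ := by
    have h1 : ∫⁻ τ in Ioo 0 (t - s), ∫⁻ x, ‖f (τ + s) x‖ₑ * ‖u (τ + s) x‖ₑ =
        ∫⁻ τ in Ioo s t, ∫⁻ x, ‖f τ x‖ₑ * ‖u τ x‖ₑ :=
      hshift (fun τ => ∫⁻ x, ‖f τ x‖ₑ * ‖u τ x‖ₑ)
    rw [h1]
    exact hfu s t hs hst htT
  have hE := h'.energyEq hts hmemI (ENNReal.pow_ne_top hLt) hM hgradI hu₃I hpuI hfuI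
    le_rfl hts.le le_rfl
  -- undo the translation
  have hD : ∫⁻ τ in Ioo 0 (t - s), ∫⁻ x,
      ENNReal.ofReal (frobeniusNormSq (fderiv ℝ (u (τ + s)) x)) =
      ∫⁻ τ in Ioo s t, ∫⁻ x, ENNReal.ofReal (frobeniusNormSq (fderiv ℝ (u τ) x)) :=
    hshift (fun τ => ∫⁻ x, ENNReal.ofReal (frobeniusNormSq (fderiv ℝ (u τ) x)))
  have hF : ∫ τ in (0 : ℝ)..(t - s), ∫ x, ⟪f (τ + s) x, u (τ + s) x⟫ =
      ∫ τ in s..t, ∫ x, ⟪f τ x, u τ x⟫ := by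
    have h1 := intervalIntegral.integral_comp_add_right (a := 0) (b := t - s)
      (fun τ => ∫ x, ⟪f τ x, u τ x⟫) s
    simpa only [zero_add, sub_add_cancel] using h1
  simp only [sub_add_cancel, zero_add] at hE
  rw [hD, hF] at hE
  exact hE

end InteriorEnergy

/-! ### The Leray–Hopf structure -/

section LerayHopfStructure

variable {E : Type*} [NormedAddCommGroup E] [InnerProductSpace ℝ E] [FiniteDimensional ℝ E]
  [MeasurableSpace E] [BorelSpace E]

/-- **The force pairing `τ ↦ ∫⟪f, u⟫(τ)` is integrable on `(0, T)`** when `⟪f, u⟫` is jointly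
continuous on the open slab (e.g. for a classical solution) and `∫₀ᵀ∫ |f| |u| < ∞` (Tonelli
and Fubini: the integrand is integrable for `dt|_(0,T) ⊗ dx`). [folklore] -/
theorem integrableOn_forcePairing_of_continuousOn {T : ℝ} {f u : ℝ → E → E}
    (hf : ContinuousOn (uncurry f) (Ioo 0 T ×ˢ univ))
    (hu : ContinuousOn (uncurry u) (Ioo 0 T ×ˢ univ))
    (hfu : ∫⁻ τ in Ioo 0 T, ∫⁻ x, ‖f τ x‖ₑ * ‖u τ x‖ₑ < ∞) :
    IntegrableOn (fun τ => ∫ x, ⟪f τ x, u τ x⟫) (Ioo 0 T) volume := by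
  have hcont : ContinuousOn (fun z : ℝ × E => ⟪f z.1 z.2, u z.1 z.2⟫) (Ioo 0 T ×ˢ univ) :=
    hf.inner hu
  have hmeasG : AEStronglyMeasurable (fun z : ℝ × E => ⟪f z.1 z.2, u z.1 z.2⟫)
      (((volume : Measure ℝ).restrict (Ioo 0 T)).prod (volume : Measure E)) := by
    rw [← volume_restrict_slab_eq]
    exact hcont.aestronglyMeasurable (measurableSet_Ioo.prod MeasurableSet.univ)
  have hGint : Integrable (fun z : ℝ × E => ⟪f z.1 z.2, u z.1 z.2⟫)
      (((volume : Measure ℝ).restrict (Ioo 0 T)).prod (volume : Measure E)) := by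
    refine ⟨hmeasG, ?_⟩
    unfold HasFiniteIntegral
    calc ∫⁻ z, ‖⟪f z.1 z.2, u z.1 z.2⟫‖ₑ
          ∂(((volume : Measure ℝ).restrict (Ioo 0 T)).prod (volume : Measure E))
        ≤ ∫⁻ τ in Ioo 0 T, ∫⁻ x, ‖⟪f τ x, u τ x⟫‖ₑ := lintegral_prod_le _
      _ ≤ ∫⁻ τ in Ioo 0 T, ∫⁻ x, ‖f τ x‖ₑ * ‖u τ x‖ₑ := by
          -- Cauchy–Schwarz `‖⟪a, b⟫‖ₑ ≤ ‖a‖ₑ ‖b‖ₑ` (cf. `BMOInv.enorm_inner_le`, not imported)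
          refine lintegral_mono fun τ => lintegral_mono fun x => ?_
          rw [enorm_eq_nnnorm, enorm_eq_nnnorm, enorm_eq_nnnorm, ← ENNReal.coe_mul]
          exact ENNReal.coe_le_coe.2 (nnnorm_inner_le_nnnorm _ _)
      _ < ∞ := hfu
  exact hGint.integral_prod_left

/-- **A forced classical solution on an open time strip, continuous into `L²` at `t = 0⁺`, is a
Leray–Hopf weak solution from the datum it attains, on every `[0, T']`, `T' < T`** — the forced
twin of `isLerayHopfOn_of_classical_Ioo` (Ożański–Pooley 2018, Lemma 6.21 with Def. 6.20;
Leray 1934, §17 (3.4) and §32, p. 242: "toute solution régulière constitue a fortiori une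
solution turbulente"). Let `(u, p)` be a classical solution of the Navier–Stokes system with
force `f` on `E × (0, T)` with `‖u(t)‖_{L²} ≤ L < ∞` there, `∇u ∈ L²((0,T) × E)`,
`⟪f, u⟫ ∈ L¹((0,T) × E)`, `f ∈ L¹` on the finite cylinders `(0,T) × K`, and, on the interior
slabs `(s, t) × E` (`0 < s < t < T`), `u ∈ L³` and `p u ∈ L¹`; let `v = u` on `(0, T)`,
`v(0) = u₀ ∈ L²`, and `v ∈ C([0, T); L²)`. Then `v` is a Leray–Hopf weak solution on `[0, T')`
with force `f` and datum `u₀` (`IsLerayHopfOn T' ν f u₀ v`) for every `0 < T' < T`: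
* the weak formulation with the datum term is the cut-off argument
  `weakIdentity_datum_of_tested` (Robinson–Rodrigo–Sadowski 2016, §3.1) applied to the
  pressure-free identity on the open slab (`IsClassicalNSSolutionOn.weakIdentity_test_Ioo`) and
  the strong `L²` attainment of `u₀`;
* the energy inequalities are **equalities**: on interior intervals by `energyEq_Ioo_forced`,
  and from `t = 0` by letting `s → 0⁺` — `E(v(s)) → E(u₀)` by the `L²` continuity, the
  dissipation integral by monotone convergence (`tendsto_setLIntegral_Ioo_left`), the work of the
  force `∫ₛᵗ∫⟪f, u⟫ → ∫₀ᵗ∫⟪f, u⟫` by continuity of the primitive of the integrable pairing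
  (`integrableOn_forcePairing_of_continuousOn`);
* weak and strong continuity from `v ∈ C([0, T); L²)`; the classical gradient is the weak
  gradient.
Nothing is assumed at `t = 0` beyond the `L²` attainment of the datum: this is the form in
which smooth-for-positive-times solutions (e.g. self-similar ones, `u = t^{-1/2}U(x/√t)` with a
force `t^{-3/2}F(x/√t)`) are recognised as Leray–Hopf solutions. [cite: OzanskiPooley2018, Lemma 6.21 with Def. 6.20] [cite: Leray1934, §17 (3.4), §32 p. 242] -/
theorem isLerayHopfOn_of_classical_Ioo_forced {ν T T' : ℝ} {L : ℝ≥0∞} (hT' : 0 < T')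
    (hT'T : T' < T) {u v f : ℝ → E → E} {p : ℝ → E → ℝ} {u₀ : E → E}
    (hcl : IsClassicalNSSolutionOn (Ioo 0 T) ν f u p) (hvw : ∀ t ∈ Ioo 0 T, v t = u t)
    (hv0 : v 0 = u₀) (hu₀ : MemLp u₀ 2 volume) (hvc : ContinuousInLpOn (Ico 0 T) 2 v)
    (hLt : L ≠ ⊤) (hL : ∀ t ∈ Ioo 0 T, eLpNorm (u t) 2 volume ≤ L)
    (hgrad : ∫⁻ τ in Ioo 0 T, ∫⁻ x, ENNReal.ofReal (frobeniusNormSq (fderiv ℝ (u τ) x)) < ∞)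
    (hu₃ : ∀ s t : ℝ, 0 < s → s < t → t < T →
      ∫⁻ τ in Ioo s t, ∫⁻ x, ‖u τ x‖ₑ ^ (3 : ℕ) < ∞)
    (hpu : ∀ s t : ℝ, 0 < s → s < t → t < T →
      ∫⁻ τ in Ioo s t, ∫⁻ x, ‖p τ x‖ₑ * ‖u τ x‖ₑ < ∞)
    (hfu : ∫⁻ τ in Ioo 0 T, ∫⁻ x, ‖f τ x‖ₑ * ‖u τ x‖ₑ < ∞)
    (hfK : ∀ K : Set E, IsCompact K → IntegrableOn (uncurry f) (Ioo 0 T ×ˢ K) volume) :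
    IsLerayHopfOn T' ν f u₀ v := by
  have hT : 0 < T := hT'.trans hT'T
  set D : ℝ → ℝ≥0∞ := fun τ => ∫⁻ x, ENNReal.ofReal (frobeniusNormSq (fderiv ℝ (u τ) x))
    with hD_def
  have hIoo : ∀ {t : ℝ}, t ∈ Ioo 0 T' → t ∈ Ioo 0 T := fun ht => ⟨ht.1, ht.2.trans hT'T⟩
  have hfilter : 𝓝[>] (0 : ℝ) ≤ 𝓝[Ico 0 T] 0 :=
    nhdsWithin_le_of_mem (mem_of_superset (Ioo_mem_nhdsGT hT) Ioo_subset_Ico_self)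
  -- the slices
  have hmem : ∀ t ∈ Ioo 0 T, MemLp (u t) 2 volume := fun t ht =>
    ⟨(hcl.contDiff_velocity ht).continuous.aestronglyMeasurable, (hL t ht).trans_lt hLt.lt_top⟩
  have hmemv : ∀ t ∈ Icc 0 T', MemLp (v t) 2 volume := by
    intro t ht
    rcases ht.1.eq_or_lt with h | h
    · rw [← h, hv0]
      exact hu₀
    · have htT : t ∈ Ioo 0 T := ⟨h, ht.2.trans_lt hT'T⟩
      rw [hvw t htT]
      exact hmem t htT
  -- interior slabs
  have hgrad' : ∀ s t : ℝ, 0 < s → s < t → t < T → ∫⁻ τ in Ioo s t, D τ < ∞ :=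
    fun s t hs _ htT => (lintegral_mono_set (Ioo_subset_Ioo hs.le htT.le)).trans_lt hgrad
  have hfu' : ∀ s t : ℝ, 0 < s → s < t → t < T →
      ∫⁻ τ in Ioo s t, ∫⁻ x, ‖f τ x‖ₑ * ‖u τ x‖ₑ < ∞ :=
    fun s t hs _ htT => (lintegral_mono_set (Ioo_subset_Ioo hs.le htT.le)).trans_lt hfu
  have hEI : ∀ {s t : ℝ}, 0 < s → s < t → t < T → VectorCalculus.kineticEnergy (u t) +
      ν * (∫⁻ τ in Ioo s t, D τ).toReal =
      VectorCalculus.kineticEnergy (u s) + ∫ τ in s..t, ∫ x, ⟪f τ x, u τ x⟫ :=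
    fun hs hst htT => hcl.energyEq_Ioo_forced hLt hL hgrad' hu₃ hpu hfu' hs hst htT
  -- the classical solution on the shorter open interval
  have hcl' : IsClassicalNSSolutionOn (Ioo 0 T') ν f u p :=
    hcl.mono (Ioo_subset_Ioo_right hT'T.le) isOpen_Ioo.uniqueDiffOn
  -- measurability of `v` on the slab
  have hcont : ContinuousOn (uncurry u) (Ioo 0 T' ×ˢ univ) := hcl'.smooth_velocity.continuousOn
  have hmeas : AEStronglyMeasurable (uncurry v) (volume.restrict (Ioo 0 T' ×ˢ univ)) := by
    refine (hcont.aestronglyMeasurable (measurableSet_Ioo.prod MeasurableSet.univ)).congr ?_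
    filter_upwards [ae_restrict_mem (measurableSet_Ioo.prod MeasurableSet.univ)] with z hz
    change u z.1 z.2 = v z.1 z.2
    rw [hvw z.1 (hIoo (mem_prod.1 hz).1)]
  -- square integrability on the slab `(0, T') × E` (hence on the cylinders)
  have hL2loc : ∀ K : Set E, IsCompact K → ∫⁻ z in Ioo 0 T' ×ˢ K, ‖uncurry v z‖ₑ ^ 2 < ∞ := by
    intro K _
    calc ∫⁻ z in Ioo 0 T' ×ˢ K, ‖uncurry v z‖ₑ ^ 2
        ≤ ∫⁻ z in Ioo 0 T' ×ˢ univ, ‖uncurry v z‖ₑ ^ 2 :=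
          lintegral_mono_set (prod_mono Subset.rfl (subset_univ _))
      _ = ∫⁻ z, ‖uncurry v z‖ₑ ^ 2
            ∂(((volume : Measure ℝ).restrict (Ioo 0 T')).prod (volume : Measure E)) := by
          rw [volume_restrict_slab_eq]
      _ ≤ ∫⁻ t in Ioo 0 T', ∫⁻ x, ‖uncurry v (t, x)‖ₑ ^ 2 := lintegral_prod_le _
      _ ≤ ∫⁻ _ in Ioo 0 T', L ^ 2 := by
          refine setLIntegral_mono' measurableSet_Ioo fun t ht => ?_
          calc ∫⁻ x, ‖uncurry v (t, x)‖ₑ ^ 2 = eEnergy (u t) := by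
                simp only [uncurry_apply_pair, hvw t (hIoo ht)]
                rfl
            _ ≤ L ^ 2 := by
                rw [eEnergy_eq_eLpNorm_sq]
                gcongr
                exact hL t (hIoo ht)
      _ < ∞ := by
          rw [setLIntegral_const]
          exact ENNReal.mul_lt_top (ENNReal.pow_ne_top hLt).lt_top measure_Ioo_lt_top
  -- the divergence constraint
  have hdivae : ∀ᵐ t ∂(volume.restrict (Ioo 0 T')), IsWeaklyDivFree (v t) :=
    (ae_restrict_iff' measurableSet_Ioo).2 (Eventually.of_forall fun t ht => by
      rw [hvw t (hIoo ht)]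
      exact VectorCalculus.IsDivFree.isWeaklyDivFree_holds (hcl.divFree t (hIoo ht))
        (contDiff_infty.1 (hcl.contDiff_velocity (hIoo ht)) 1))
  -- strong `L²` attainment of the datum
  have h0 : Tendsto (fun t => eLpNorm (v t - u₀) 2 volume) (𝓝[>] 0) (𝓝 0) := by
    have h1 := hvc.2 0 (left_mem_Ico.2 hT)
    rw [hv0] at h1
    exact h1.mono_left hfilter
  -- the weak formulation with the datum term
  have hweak : IsWeakNSSolutionOn T' ν f u₀ v := by
    refine ⟨hmeas, hL2loc, hdivae, fun ψ hψ hψdiv => ?_⟩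
    have hUK := fun K (hK : IsCompact K) =>
      integrableOn_cylinder_of_lintegral_sq_slab hmeas hL2loc hK
    have hgood := ae_slice_aestronglyMeasurable_and_lintegral_ball_lt_top hmeas hL2loc
    have hmom : ∀ φ : ℝ → E → E, IsSpaceTimeTestOn (slab E (Ioo 0 T') isOpen_Ioo) φ →
        (∀ t, VectorCalculus.IsDivFree (φ t)) →
        ∫ t in Ioo 0 T', ∫ x, (⟪v t x, timeDeriv φ t x⟫ + ⟪v t x, convect (v t) (φ t) x⟫ +
          ν * ⟪v t x, Δ (φ t) x⟫ + ⟪f t x, φ t x⟫) = 0 := by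
      intro φ hφ hφdiv
      calc ∫ t in Ioo 0 T', ∫ x, (⟪v t x, timeDeriv φ t x⟫ + ⟪v t x, convect (v t) (φ t) x⟫ +
              ν * ⟪v t x, Δ (φ t) x⟫ + ⟪f t x, φ t x⟫)
          = ∫ t in Ioo 0 T', ∫ x, (⟪u t x, timeDeriv φ t x⟫ +
              ⟪u t x, convect (u t) (φ t) x⟫ + ν * ⟪u t x, Δ (φ t) x⟫ + ⟪f t x, φ t x⟫) := by
            refine setIntegral_congr_fun measurableSet_Ioo fun t ht => ?_
            simp only [hvw t (hIoo ht)]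
        _ = 0 := hcl'.weakIdentity_test_Ioo hφ hφdiv
    have h₀ : ∀ K : Set E, IsCompact K →
        Tendsto (fun t => ∫⁻ x in K, ‖v t x - u₀ x‖ₑ ^ 2) (𝓝[>] 0) (𝓝 0) := by
      intro K _
      have hsq : Tendsto (fun t => eLpNorm (v t - u₀) 2 volume ^ 2) (𝓝[>] 0) (𝓝 0) := by
        simpa using ENNReal.Tendsto.pow (n := 2) h0
      refine tendsto_of_tendsto_of_tendsto_of_le_of_le tendsto_const_nhds hsq
        (fun _ => zero_le) fun t => ?_
      calc ∫⁻ x in K, ‖v t x - u₀ x‖ₑ ^ 2 ≤ ∫⁻ x, ‖(v t - u₀) x‖ₑ ^ 2 :=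
            setLIntegral_le_lintegral _ _
        _ = eLpNorm (v t - u₀) 2 volume ^ 2 := eEnergy_eq_eLpNorm_sq _
    have hfK' : ∀ K : Set E, IsCompact K → IntegrableOn (uncurry f) (Ioo 0 T' ×ˢ K) volume :=
      fun K hK => (hfK K hK).mono_set (prod_mono (Ioo_subset_Ioo_right hT'T.le) Subset.rfl)
    exact weakIdentity_datum_of_tested hT' hUK hmom hfK' hgood hu₀.1 h₀ hψ hψdiv
  -- the dissipation is finite on `(0, T')`
  have hDfin : ∫⁻ τ in Ioo 0 T', D τ < ⊤ :=
    (lintegral_mono_set (Ioo_subset_Ioo_right hT'T.le)).trans_lt hgrad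
  -- the work of the force is an integrable function of time
  have hΦint : IntegrableOn (fun τ => ∫ x, ⟪f τ x, u τ x⟫) (Ioo 0 T) volume :=
    integrableOn_forcePairing_of_continuousOn (hcl.continuousOn_force isOpen_Ioo.uniqueDiffOn)
      hcl.smooth_velocity.continuousOn hfu
  -- the energy equality from `t = 0`
  have hEq0 : ∀ t ∈ Ioc 0 T', VectorCalculus.kineticEnergy (v t) +
      ν * (∫⁻ τ in Ioo 0 t, D τ).toReal =
      VectorCalculus.kineticEnergy u₀ + ∫ τ in (0 : ℝ)..t, ∫ x, ⟪f τ x, u τ x⟫ := by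
    intro t ht
    have htT : t ∈ Ioo 0 T := ⟨ht.1, ht.2.trans_lt hT'T⟩
    have h1 : Tendsto (fun s => ∫⁻ τ in Ioo s t, D τ) (𝓝[>] 0) (𝓝 (∫⁻ τ in Ioo 0 t, D τ)) :=
      tendsto_setLIntegral_Ioo_left le_rfl ht.2 hDfin
    have hfin : ∫⁻ τ in Ioo 0 t, D τ ≠ ⊤ :=
      ((lintegral_mono_set (Ioo_subset_Ioo_right ht.2)).trans_lt hDfin).ne
    have h2 : Tendsto (fun s => (∫⁻ τ in Ioo s t, D τ).toReal) (𝓝[>] 0)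
        (𝓝 (∫⁻ τ in Ioo 0 t, D τ).toReal) :=
      (ENNReal.tendsto_toReal hfin).comp h1
    have h3 : Tendsto (fun s => VectorCalculus.kineticEnergy (v t) +
        ν * (∫⁻ τ in Ioo s t, D τ).toReal) (𝓝[>] 0)
        (𝓝 (VectorCalculus.kineticEnergy (v t) + ν * (∫⁻ τ in Ioo 0 t, D τ).toReal)) :=
      tendsto_const_nhds.add (h2.const_mul ν)
    have h4 : Tendsto (fun s => VectorCalculus.kineticEnergy (v s)) (𝓝[>] 0)
        (𝓝 (VectorCalculus.kineticEnergy u₀)) := by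
      have h5 := hvc.tendsto_kineticEnergy (left_mem_Ico.2 hT)
      rw [hv0] at h5
      exact h5.mono_left hfilter
    have h6 : Tendsto (fun s => ∫ τ in s..t, ∫ x, ⟪f τ x, u τ x⟫) (𝓝[>] 0)
        (𝓝 (∫ τ in (0 : ℝ)..t, ∫ x, ⟪f τ x, u τ x⟫)) := by
      have hint : IntegrableOn (fun τ => ∫ x, ⟪f τ x, u τ x⟫) (uIcc 0 t) volume := by
        rw [uIcc_of_le ht.1.le, integrableOn_Icc_iff_integrableOn_Ioo]
        exact hΦint.mono_set (Ioo_subset_Ioo_right htT.2.le)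
      have hc := (intervalIntegral.continuousOn_primitive_interval_left hint) 0
        (by rw [uIcc_of_le ht.1.le]; exact left_mem_Icc.2 ht.1.le)
      have hle : 𝓝[>] (0 : ℝ) ≤ 𝓝[uIcc 0 t] 0 := nhdsWithin_le_of_mem (by
        rw [uIcc_of_le ht.1.le]
        exact mem_of_superset (Ioo_mem_nhdsGT ht.1) Ioo_subset_Icc_self)
      exact hc.tendsto.mono_left hle
    have h7 := h4.add h6
    have heq : (fun s => VectorCalculus.kineticEnergy (v t) + ν * (∫⁻ τ in Ioo s t, D τ).toReal)
        =ᶠ[𝓝[>] 0] fun s => VectorCalculus.kineticEnergy (v s) +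
          ∫ τ in s..t, ∫ x, ⟪f τ x, u τ x⟫ := by
      filter_upwards [Ioo_mem_nhdsGT ht.1] with s hs
      rw [hvw t htT, hvw s ⟨hs.1, hs.2.trans htT.2⟩]
      exact hEI hs.1 hs.2 htT.2
    exact tendsto_nhds_unique (h3.congr' heq) h7
  -- the work of the force against `v` is that against `u`
  have hforce : ∀ a b : ℝ, 0 ≤ a → a ≤ b → b < T →
      ∫ τ in a..b, ∫ x, ⟪f τ x, v τ x⟫ = ∫ τ in a..b, ∫ x, ⟪f τ x, u τ x⟫ := by
    intro a b ha hab hbT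
    refine intervalIntegral.integral_congr_ae (Eventually.of_forall fun τ hτ => ?_)
    rw [uIoc_of_le hab] at hτ
    rw [hvw τ ⟨ha.trans_lt hτ.1, hτ.2.trans_lt hbT⟩]
  have hvc' : ContinuousInLpOn (Icc 0 T') 2 v := hvc.mono (Icc_subset_Ico_right hT'T)
  refine ⟨hweak, ⟨(L ^ 2).toNNReal, ?_⟩, hmemv,
    ⟨fun t => fderiv ℝ (u t), ?_, hDfin, fun t ht => ?_, ?_⟩, fun w hw => ⟨?_, ?_⟩, h0⟩
  · -- the `L^∞_t L²_x` bound
    refine (ae_restrict_iff' measurableSet_Ioo).2 (Eventually.of_forall fun t ht => ?_)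
    rw [ENNReal.coe_toNNReal (ENNReal.pow_ne_top hLt), hvw t (hIoo ht), eEnergy_eq_eLpNorm_sq]
    gcongr
    exact hL t (hIoo ht)
  · -- the classical gradient is a weak gradient
    refine (ae_restrict_iff' measurableSet_Ioo).2 (Eventually.of_forall fun t ht => ?_)
    rw [hvw t (hIoo ht)]
    exact hasWeakGradient_fderiv_of_contDiff
      (contDiff_infty.1 (hcl.contDiff_velocity (hIoo ht)) 1)
  · -- the energy (in)equality from `0`
    rcases ht.1.eq_or_lt with h | h
    · rw [← h, hv0]
      simp
    · rw [hforce 0 t le_rfl ht.1 (ht.2.trans_lt hT'T)]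
      exact (hEq0 t ⟨h, ht.2⟩).le
  · -- the energy (in)equality from every `s ∈ (0, T')`
    refine (ae_restrict_iff' measurableSet_Ioo).2 (Eventually.of_forall fun s hs t ht => ?_)
    rcases ht.1.eq_or_lt with h | h
    · rw [← h]
      simp
    · rw [hforce s t hs.1.le ht.1 (ht.2.trans_lt hT'T), hvw t ⟨hs.1.trans h, ht.2.trans_lt hT'T⟩,
        hvw s (hIoo hs)]
      exact (hEI hs.1 h (ht.2.trans_lt hT'T)).le
  · -- weak continuity on `(0, T']`
    exact (hvc'.continuousOn_integral_inner hw).mono Ioc_subset_Icc_self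
  · -- weak attainment of the datum
    refine tendsto_integral_inner_left_of_tendsto_eLpNorm hw ?_ hu₀ h0
    filter_upwards [Ioo_mem_nhdsGT hT'] with t ht
    exact hmemv t ⟨ht.1.le, ht.2.le⟩

end LerayHopfStructure

end Literature.Analysis.FluidPDE

end
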